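import Summits.KontsevichZagierPeriods.KontsevichZagierPeriods.Theorems.HyperbolicBlochOffTetraSectorKernelStubRayCarriersExistRay

/-!
# `OffTetraSectorKernel`, line `odd-hyperbolic-ladder`: the ray carriers exist
(stub `stub_rayCarriersExist`)

Registered existence stub of the crux `OffTetraSectorKernel` (stmt-KontsevichZagierPeriods-10557,
route HyperbolicBloch, skeleton v11 "the Bloch–Wigner oracle is divisible"). For real algebraic
`a, b` (`z = a + ib`) put `q(s) = (1 − s a)² + (s b)²` and `g(s) = b / q(s) = Im (z / (1 − s z))`.
Three carriers of the distribution relations ARE Kontsevich–Zagier integral representations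
(`KZ.IntegralRep`: `ℚ`-semialgebraic domain, `ℚ`-semialgebraic integrand, absolutely convergent
integral):

* the ARC CARRIER `C(a, b) = [(0,1), g]`: `|g| ≤ (a² + b²)/|b|` (`KZ.rayDilog_sq_le_mul_den`), a
  bounded rational integrand on a bounded interval;
* the SIGNED LOG SHEET `Λ±(r) = [{1 < t < r} ∪ {r < t < 1}, sgn(t − 1)/t]` (value `log r`) for real
  algebraic `r > 0`: `|integrand| ≤ max 1 r⁻¹` on a bounded set;
* the SQUARE-ROOTED RAY REPRESENTATION
  `Ray₁(a, b, r) = [{0 < s < 1, u strictly between 1 and s r}, sgn(u − 1)(−b)/(u q(s))]`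
  (`b > 0`, `r > 0`): the sibling helper file `…StubRayCarriersExistRay.lean`
  (`rayCarriersAux_ray`, adapted from `KZ.rayDilogRep`).

References: M. Kontsevich, D. Zagier, *Periods* (2001), §1.1; D. Zagier, *The dilogarithm
function* (2007), Ch. I §3. No definitions are introduced.
-/

noncomputable section

open Set MeasureTheory MvPolynomial
open Literature.NumberTheory.Transcendental Literature.ModelTheory.ExponentialFields

namespace Summit.KontsevichZagierPeriods.HyperbolicBloch.OffTetraSectorKernel

/-! ### Finite volume in `ℝ¹` -/

/-- A subset of `ℝ¹` whose unique coordinate is confined to `[0, c]` has finite volume.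
[cite: KontsevichZagier2001, §1.1] -/
theorem rayCarriers_volume_ne_top {S : Set (Fin 1 → ℝ)} (c : ℝ)
    (hS : ∀ t ∈ S, 0 ≤ t 0 ∧ t 0 ≤ c) : volume S ≠ ⊤ := by
  refine (Bornology.IsBounded.measure_lt_top ?_).ne
  refine (Metric.isBounded_Icc (fun _ : Fin 1 => (0 : ℝ)) (fun _ => c)).subset ?_
  intro t ht
  refine ⟨fun i => ?_, fun i => ?_⟩
  · obtain rfl : i = 0 := Subsingleton.elim _ _
    exact (hS t ht).1
  · obtain rfl : i = 0 := Subsingleton.elim _ _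
    exact (hS t ht).2

/-! ### The arc carrier `C(a, b) = [(0,1), g]` -/

/-- The arc integrand `g(t) = b / ((1 − t a)² + (t b)²)` is `ℚ`-semialgebraic on `(0,1) ⊆ ℝ¹` for
real algebraic `a`, `b` (a quotient of `ℚ̄`-polynomials with non-vanishing denominator when
`b ≠ 0`; identically `0` when `b = 0`). [cite: KontsevichZagier2001, §1.1] -/
theorem rayCarriers_arc_isSemialgebraicFunOn {a b : ℝ} (ha : IsAlgebraic ℚ a)
    (hb : IsAlgebraic ℚ b) :
    IsSemialgebraicFunOn ℚ {t : Fin 1 → ℝ | 0 < t 0 ∧ t 0 < 1}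
      (fun t => b / ((1 - t 0 * a) ^ 2 + (t 0 * b) ^ 2)) := by
  have hD : IsSemialgebraic ℚ {t : Fin 1 → ℝ | 0 < t 0 ∧ t 0 < 1} :=
    isSemialgebraic_unitInterval_fin_one
  by_cases hb0 : b = 0
  · refine (isSemialgebraicFunOn_natCast hD 0).congr fun t _ => ?_
    simp [hb0]
  have h0 : IsSemialgebraicFunOn ℚ {t : Fin 1 → ℝ | 0 < t 0 ∧ t 0 < 1} (fun t => t 0) := by
    simpa using isSemialgebraicFunOn_aeval hD (X 0 : MvPolynomial (Fin 1) ℚ)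
  have haC := isSemialgebraicFunOn_const_of_isAlgebraic hD ha
  have hbC := isSemialgebraicFunOn_const_of_isAlgebraic hD hb
  have hden : IsSemialgebraicFunOn ℚ {t : Fin 1 → ℝ | 0 < t 0 ∧ t 0 < 1}
      (fun t => (1 - t 0 * a) ^ 2 + (t 0 * b) ^ 2) := by
    have e1 := IsSemialgebraicFunOn.sub_holds (isSemialgebraicFunOn_natCast hD 1)
      (IsSemialgebraicFunOn.mul_holds h0 haC)
    have e2 := IsSemialgebraicFunOn.mul_holds h0 hbC
    have h := IsSemialgebraicFunOn.add_holds (IsSemialgebraicFunOn.mul_holds e1 e1)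
      (IsSemialgebraicFunOn.mul_holds e2 e2)
    refine h.congr fun t _ => ?_
    simp only [Pi.mul_apply, Pi.add_apply, Pi.sub_apply, Nat.cast_one]
    ring
  have hden0 : ∀ t ∈ {t : Fin 1 → ℝ | 0 < t 0 ∧ t 0 < 1}, (1 - t 0 * a) ^ 2 + (t 0 * b) ^ 2 ≠ 0 :=
    fun t _ => (KZ.rayDilog_den_pos hb0 a (t 0)).ne'
  exact hbC.div hden hden0

/-- The arc integrand `g(t) = b / ((1 − t a)² + (t b)²)` is absolutely integrable on `(0,1) ⊆ ℝ¹`: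
it is bounded by `(a² + b²)/|b|` (`KZ.rayDilog_sq_le_mul_den`; it vanishes for `b = 0`) on a set
of finite volume. [cite: KontsevichZagier2001, §1.1] -/
theorem rayCarriers_arc_integrableOn (a b : ℝ) :
    IntegrableOn (fun t : Fin 1 → ℝ => b / ((1 - t 0 * a) ^ 2 + (t 0 * b) ^ 2))
      {t : Fin 1 → ℝ | 0 < t 0 ∧ t 0 < 1} := by
  have hm : Measurable (fun t : Fin 1 → ℝ => b / ((1 - t 0 * a) ^ 2 + (t 0 * b) ^ 2)) :=
    measurable_const.div (by fun_prop)
  have hvol : volume {t : Fin 1 → ℝ | 0 < t 0 ∧ t 0 < 1} ≠ ⊤ :=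
    rayCarriers_volume_ne_top 1 fun t ht => ⟨ht.1.le, ht.2.le⟩
  refine Measure.integrableOn_of_bounded (M := (a ^ 2 + b ^ 2) / |b|) hvol hm.aestronglyMeasurable
    (Filter.Eventually.of_forall fun t => ?_)
  rw [Real.norm_eq_abs]
  by_cases hb0 : b = 0
  · simp [hb0]
  rw [abs_div, abs_of_pos (KZ.rayDilog_den_pos hb0 a (t 0))]
  exact rayCarriers_abs_div_den_le a hb0 (t 0)

/-- Conjunct (1) of `stub_rayCarriersExist`: the ARC CARRIER `C(a, b) = [(0,1), g]`,
`g(t) = b / ((1 − t a)² + (t b)²)` (value `−arg(1 − z)`), IS an integral representation for real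
algebraic `a`, `b`. [cite: KontsevichZagier2001, §1.1] -/
theorem rayCarriers_arc (a b : ℝ) (ha : IsAlgebraic ℚ a) (hb : IsAlgebraic ℚ b) :
    ∃ C : KZ.IntegralRep 1, C.domain = {t | 0 < t 0 ∧ t 0 < 1} ∧
      C.integrand = fun t => b / ((1 - t 0 * a) ^ 2 + (t 0 * b) ^ 2) :=
  ⟨⟨_, _, isSemialgebraic_unitInterval_fin_one, rayCarriers_arc_isSemialgebraicFunOn ha hb,
    rayCarriers_arc_integrableOn a b⟩, rfl, rfl⟩

/-! ### The signed log sheet `Λ±(r) = [{1 < t < r} ∪ {r < t < 1}, sgn(t − 1)/t]` -/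

/-- The signed log sheet `{1 < t < r} ∪ {r < t < 1} ⊆ ℝ¹` is `ℚ`-semialgebraic for real algebraic
`r` (a Boolean combination of sign conditions on `ℚ̄`-polynomials).
[cite: KontsevichZagier2001, §1.1] -/
theorem rayCarriers_logSheet_isSemialgebraic {r : ℝ} (hr : IsAlgebraic ℚ r) :
    IsSemialgebraic ℚ {t : Fin 1 → ℝ | (1 < t 0 ∧ t 0 < r) ∨ (r < t 0 ∧ t 0 < 1)} := by
  have hu : IsSemialgebraic ℚ (univ : Set (Fin 1 → ℝ)) := isSemialgebraic_univ
  have h0 : IsSemialgebraicFunOn ℚ (univ : Set (Fin 1 → ℝ)) (fun t => t 0) := by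
    simpa using isSemialgebraicFunOn_aeval hu (X 0 : MvPolynomial (Fin 1) ℚ)
  have hrC := isSemialgebraicFunOn_const_of_isAlgebraic hu hr
  have hB : IsSemialgebraic ℚ {t : Fin 1 → ℝ | t 0 < r} := by
    convert (IsSemialgebraicFunOn.sub_holds h0 hrC).isSemialgebraic_sep_neg using 1
    ext t
    simp [sub_neg]
  have hC : IsSemialgebraic ℚ {t : Fin 1 → ℝ | r < t 0} := by
    convert (IsSemialgebraicFunOn.sub_holds hrC h0).isSemialgebraic_sep_neg using 1
    ext t
    simp [sub_neg]
  have hP1 : IsSemialgebraic ℚ {t : Fin 1 → ℝ | 1 < t 0} := by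
    simpa using isSemialgebraic_setOf_eval_lt (k := ℚ) (R := ℝ) 1 (X 0 : MvPolynomial (Fin 1) ℚ)
  have hP2 : IsSemialgebraic ℚ {t : Fin 1 → ℝ | t 0 < 1} := by
    simpa using isSemialgebraic_setOf_eval_lt (k := ℚ) (R := ℝ) (X 0 : MvPolynomial (Fin 1) ℚ) 1
  convert (hP1.inter hB).union (hC.inter hP2) using 1
  ext t
  simp only [mem_setOf_eq, mem_inter_iff, mem_union]

/-- The sign factor `sgn(t − 1)` is a `ℚ`-semialgebraic function on `ℝ¹` (two constants glued
along `{1 < t}` and its complement). [cite: KontsevichZagier2001, §1.1] -/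
theorem rayCarriers_logSheet_isSemialgebraicFunOn_sign :
    IsSemialgebraicFunOn ℚ (univ : Set (Fin 1 → ℝ)) (fun t => if 1 < t 0 then (1 : ℝ) else -1) := by
  have hP1 : IsSemialgebraic ℚ {t : Fin 1 → ℝ | 1 < t 0} := by
    simpa using isSemialgebraic_setOf_eval_lt (k := ℚ) (R := ℝ) 1 (X 0 : MvPolynomial (Fin 1) ℚ)
  have hf : IsSemialgebraicFunOn ℚ {t : Fin 1 → ℝ | 1 < t 0} (fun _ => (1 : ℝ)) := by
    simpa using isSemialgebraicFunOn_natCast hP1 1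
  have hg : IsSemialgebraicFunOn ℚ {t : Fin 1 → ℝ | 1 < t 0}ᶜ (fun _ => (-1 : ℝ)) :=
    (isSemialgebraicFunOn_natCast hP1.compl 1).neg.congr fun t _ => by simp
  have h := IsSemialgebraicFunOn.union hf hg (F := fun t => if 1 < t 0 then (1 : ℝ) else -1)
    (fun t ht => by simp only [mem_setOf_eq] at ht; simp [ht])
    (fun t ht => by simp only [mem_compl_iff, mem_setOf_eq] at ht; simp [ht])
  rwa [union_compl_self] at h

/-- On the signed log sheet the coordinate is positive (`t > min(1, r) > 0`).
[cite: KontsevichZagier2001, §1.1] -/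
theorem rayCarriers_logSheet_pos {r : ℝ} (hr : 0 < r) {t : Fin 1 → ℝ}
    (ht : t ∈ {t : Fin 1 → ℝ | (1 < t 0 ∧ t 0 < r) ∨ (r < t 0 ∧ t 0 < 1)}) : 0 < t 0 := by
  rcases ht with h | h
  · exact zero_lt_one.trans h.1
  · exact hr.trans h.1

/-- The signed log-sheet integrand `sgn(t − 1)/t` is `ℚ`-semialgebraic on the sheet for real
algebraic `r > 0` (the glued sign divided by the non-vanishing coordinate).
[cite: KontsevichZagier2001, §1.1] -/
theorem rayCarriers_logSheet_isSemialgebraicFunOn {r : ℝ} (hr : IsAlgebraic ℚ r) (hr0 : 0 < r) :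
    IsSemialgebraicFunOn ℚ {t : Fin 1 → ℝ | (1 < t 0 ∧ t 0 < r) ∨ (r < t 0 ∧ t 0 < 1)}
      (fun t => (if 1 < t 0 then (1 : ℝ) else -1) / t 0) := by
  have hD := rayCarriers_logSheet_isSemialgebraic hr
  have hu : IsSemialgebraic ℚ (univ : Set (Fin 1 → ℝ)) := isSemialgebraic_univ
  have h0 : IsSemialgebraicFunOn ℚ (univ : Set (Fin 1 → ℝ)) (fun t => t 0) := by
    simpa using isSemialgebraicFunOn_aeval hu (X 0 : MvPolynomial (Fin 1) ℚ)
  exact (rayCarriers_logSheet_isSemialgebraicFunOn_sign.mono (subset_univ _) hD).div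
    (h0.mono (subset_univ _) hD) fun t ht => (rayCarriers_logSheet_pos hr0 ht).ne'

/-- The signed log-sheet integrand `sgn(t − 1)/t` is absolutely integrable on the sheet for
`r > 0`: it is bounded by `max 1 r⁻¹` on a bounded set. [cite: KontsevichZagier2001, §1.1] -/
theorem rayCarriers_logSheet_integrableOn {r : ℝ} (hr : IsAlgebraic ℚ r) (hr0 : 0 < r) :
    IntegrableOn (fun t : Fin 1 → ℝ => (if 1 < t 0 then (1 : ℝ) else -1) / t 0)
      {t : Fin 1 → ℝ | (1 < t 0 ∧ t 0 < r) ∨ (r < t 0 ∧ t 0 < 1)} := by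
  have hDm : MeasurableSet {t : Fin 1 → ℝ | (1 < t 0 ∧ t 0 < r) ∨ (r < t 0 ∧ t 0 < 1)} :=
    IsSemialgebraic.measurableSet_holds (rayCarriers_logSheet_isSemialgebraic hr)
  have hm : Measurable (fun t : Fin 1 → ℝ => (if 1 < t 0 then (1 : ℝ) else -1) / t 0) :=
    (Measurable.ite (measurableSet_lt measurable_const (measurable_pi_apply 0)) measurable_const
      measurable_const).div (measurable_pi_apply 0)
  have hvol : volume {t : Fin 1 → ℝ | (1 < t 0 ∧ t 0 < r) ∨ (r < t 0 ∧ t 0 < 1)} ≠ ⊤ := by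
    refine rayCarriers_volume_ne_top (max 1 r) fun t ht =>
      ⟨(rayCarriers_logSheet_pos hr0 ht).le, ?_⟩
    rcases ht with h | h
    · exact h.2.le.trans (le_max_right _ _)
    · exact h.2.le.trans (le_max_left _ _)
  refine Measure.integrableOn_of_bounded (M := max 1 r⁻¹) hvol hm.aestronglyMeasurable ?_
  refine (ae_restrict_iff' hDm).2 (Filter.Eventually.of_forall fun t ht => ?_)
  have ht0 : 0 < t 0 := rayCarriers_logSheet_pos hr0 ht
  have hsgn : |(if 1 < t 0 then (1 : ℝ) else -1)| = 1 := by split_ifs <;> simp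
  rw [Real.norm_eq_abs, abs_div, hsgn, abs_of_pos ht0]
  rcases ht with h | h
  · exact (div_le_one_of_le₀ h.1.le ht0.le).trans (le_max_left _ _)
  · refine le_trans ?_ (le_max_right _ _)
    rw [← one_div]
    exact one_div_le_one_div_of_le hr0 h.1.le

/-- Conjunct (2) of `stub_rayCarriersExist`: the SIGNED LOG SHEET
`Λ±(r) = [{1 < t < r} ∪ {r < t < 1}, sgn(t − 1)/t]` (value `log r`) IS an integral representation
for real algebraic `r > 0`. [cite: KontsevichZagier2001, §1.1] -/
theorem rayCarriers_logSheet (r : ℝ) (hr : IsAlgebraic ℚ r) (hr0 : 0 < r) :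
    ∃ L : KZ.IntegralRep 1, L.domain = {t | (1 < t 0 ∧ t 0 < r) ∨ (r < t 0 ∧ t 0 < 1)} ∧
      L.integrand = fun t => (if 1 < t 0 then (1 : ℝ) else -1) / t 0 :=
  ⟨⟨_, _, rayCarriers_logSheet_isSemialgebraic hr, rayCarriers_logSheet_isSemialgebraicFunOn hr hr0,
    rayCarriers_logSheet_integrableOn hr hr0⟩, rfl, rfl⟩

/-! ### The registered stub -/

/-- STUB `stub_rayCarriersExist` (carriers): the arc carrier `C(a,b) = [(0,1), g]` (bounded
rational integrand), the signed log sheet `Λ±(r)` (integrand `±1/t` on an interval away from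
`0`), and the square-rooted ray representation `Ray₁(a,b,r)` (`|integrand| ≤ M/u` on a fibre
between `1` and `s r`, dominated by a product of integrable powers `s^{-1/2} u^{-1/2}`) ARE
integral representations. [cite: KontsevichZagier2001, §1.1] -/
theorem stub_rayCarriersExist :
    (∀ (a b : ℝ), IsAlgebraic ℚ a → IsAlgebraic ℚ b →
      ∃ C : KZ.IntegralRep 1, C.domain = {t | 0 < t 0 ∧ t 0 < 1} ∧
        C.integrand = fun t => b / ((1 - t 0 * a) ^ 2 + (t 0 * b) ^ 2)) ∧
    (∀ (r : ℝ), IsAlgebraic ℚ r → 0 < r →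
      ∃ L : KZ.IntegralRep 1, L.domain = {t | (1 < t 0 ∧ t 0 < r) ∨ (r < t 0 ∧ t 0 < 1)} ∧
        L.integrand = fun t => (if 1 < t 0 then (1 : ℝ) else -1) / t 0) ∧
    (∀ (a b r : ℝ), IsAlgebraic ℚ a → IsAlgebraic ℚ b → IsAlgebraic ℚ r → 0 < b → 0 < r →
      ∃ R₁ : KZ.IntegralRep 2,
        R₁.domain = {w | (0 < w 0 ∧ w 0 < 1) ∧ ((1 < w 1 ∧ w 1 < w 0 * r) ∨ (w 0 * r < w 1 ∧ w 1 < 1))} ∧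
        R₁.integrand = fun w =>
          (if 1 < w 1 then (1 : ℝ) else -1) * (-b) / (w 1 * ((1 - w 0 * a) ^ 2 + (w 0 * b) ^ 2))) :=
  ⟨rayCarriers_arc, rayCarriers_logSheet, rayCarriersAux_ray⟩

end Summit.KontsevichZagierPeriods.HyperbolicBloch.OffTetraSectorKernel

end
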